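import Literature.Topology.Immersions.NormalProjBundle
import Literature.Topology.Immersions.ProjBundleIso
import Mathlib.Geometry.Manifold.ContMDiffMFDeriv
import HarnessLib

/-!
# The immersion produced by Hirsch's theorem has the prescribed normal bundle

Topic `Literature/Topology/Immersions`. Complement to `HirschImmersionTwisted.lean` (Kirby,
*The Topology of 4-Manifolds* (1989), Ch. VI, proof of Lemma 1: *"the normal bundle `ν` of the
immersion is determined by …"* — `τ_M ⊕ E` framed `⇒` `M` immerses with normal bundle `E`;
Hirsch 1959, Thm. 6.3). The theorem there produces `F : M × ℝᵐ → ℝ^q` with `g = F(·, 0)` an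
immersion, `dg_x X = dF_{(x,0)}(X, 0)`, and `dF_{(x,0)}` injective on `T_x M × E_x`. Here we
record, in the vocabulary of projection-field bundles, that **`E ≅ ν_g`**: the bundle map

  `Φ_x = (1 - P^{tan}_x) ∘ ∂₂F(x, 0) : ℝᵐ → ℝ^q`

(`∂₂F(x,0) w = dF_{(x,0)}(0, w)`, followed by the normal projection of `g`) is a `C^∞` bundle
isomorphism from `E = E(P)` onto the normal bundle `ν_g = ProjBundle.normal … g`
(`ProjBundle.isIso_normal_of_hirschData`): it is injective on `E_x` because
`(1 - P^{tan}) (∂₂F w) = 0` means `∂₂F w = dg ξ = dF(ξ, 0)`, i.e. `dF(ξ, -w) = 0`, forcing `w = 0`.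

* `ProjBundle.contMDiff_partialFDeriv` — `x ↦ ∂₂F(x, 0)` is `C^∞` (Mathlib's
  `ContMDiffAt.mfderiv` read in the model spaces);
* `ProjBundle.partialFDeriv_apply` — `∂₂F(x, 0) w = dF_{(x,0)}(0, w)`;
* `ProjBundle.isIso_normal_of_hirschData`.

Everything here is proved; no definitions besides the plain-typed `partialFDeriv`, no named facts.

## References

* M. W. Hirsch, *Immersions of manifolds*, Trans. AMS 93 (1959), Thm. 6.3. [Hirsch1959]
* R. C. Kirby, *The Topology of 4-Manifolds*, LNM 1374 (1989), Ch. VI, Lemma 1. [Kirby1989]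
-/

open scoped Manifold ContDiff Topology
open Set Function Module

noncomputable section

namespace Literature.Topology.Immersions

/-- Local notation: `𝔼 n` is the model Euclidean space `EuclideanSpace ℝ (Fin n)`. -/
local notation "𝔼 " n:arg => EuclideanSpace ℝ (Fin n)

open Literature.Topology.FourManifolds (tangentPlane normalSpace mem_tangentPlane_iff)

namespace ProjBundle

variable {n m k q : ℕ} {M : Type*} [TopologicalSpace M] [ChartedSpace (𝔼 n) M]
  [IsManifold (𝓡 n) ∞ M]

/-- **The partial differential `∂₂F(x, 0) : ℝᵐ →L ℝ^q`** of `F : M × ℝᵐ → ℝ^q` along the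
vector factor at `(x, 0)`, as a plain continuous linear map. [folklore] -/
def partialFDeriv (F : M × 𝔼 m → 𝔼 q) (x : M) : 𝔼 m →L[ℝ] 𝔼 q :=
  mfderiv 𝓘(ℝ, 𝔼 m) 𝓘(ℝ, 𝔼 q) (fun w => F (x, w)) 0

omit [IsManifold (𝓡 n) ∞ M] in
/-- `∂₂F(x, 0) w = dF_{(x,0)}(0, w)`. [folklore] -/
theorem partialFDeriv_apply {F : M × 𝔼 m → 𝔼 q}
    (hF : ContMDiff ((𝓡 n).prod (𝓡 m)) (𝓡 q) ∞ F) (x : M) (w : 𝔼 m) :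
    partialFDeriv F x w = mfderiv ((𝓡 n).prod (𝓡 m)) (𝓡 q) F (x, 0) (0, w) := by
  have hι : ContMDiff (𝓡 m) ((𝓡 n).prod (𝓡 m)) ∞ fun s : 𝔼 m => (x, s) :=
    contMDiff_const.prodMk contMDiff_id
  have hslice : mfderiv 𝓘(ℝ, 𝔼 m) 𝓘(ℝ, 𝔼 q) (fun w => F (x, w)) 0 =
      (mfderiv ((𝓡 n).prod (𝓡 m)) (𝓡 q) F (x, 0)).comp
        (ContinuousLinearMap.inr ℝ (𝔼 n) (𝔼 m)) := by
    have hcomp : (fun w => F (x, w)) = F ∘ fun s : 𝔼 m => (x, s) := rfl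
    rw [hcomp, mfderiv_comp (0 : 𝔼 m) (g := F) (f := fun s : 𝔼 m => (x, s))
      ((hF _).mdifferentiableAt (by simp)) ((hι _).mdifferentiableAt (by simp)), mfderiv_prod_right]
    rfl
  show mfderiv 𝓘(ℝ, 𝔼 m) 𝓘(ℝ, 𝔼 q) (fun w => F (x, w)) 0 w = _
  rw [hslice]
  rfl

/-- **`x ↦ ∂₂F(x, 0)` is `C^∞`** for `C^∞` `F`. [folklore] -/
theorem contMDiff_partialFDeriv {F : M × 𝔼 m → 𝔼 q}
    (hF : ContMDiff ((𝓡 n).prod (𝓡 m)) (𝓡 q) ∞ F) :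
    ContMDiff (𝓡 n) 𝓘(ℝ, 𝔼 m →L[ℝ] 𝔼 q) ∞ (partialFDeriv F) := by
  intro x₀
  have h := ContMDiffAt.mfderiv (I := 𝓘(ℝ, 𝔼 m)) (I' := 𝓘(ℝ, 𝔼 q)) (J := 𝓡 n) (n := ∞) (m := ∞)
    (fun (x : M) (w : 𝔼 m) => F (x, w)) (fun _ => (0 : 𝔼 m)) (x₀ := x₀)
    (by exact (hF (x₀, 0))) contMDiffAt_const (by simp)
  rw [inTangentCoordinates_model_space] at h
  exact h

/-- **The Hirsch immersion has normal bundle `E`**: with the data produced by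
`ProjBundle.exists_immersion_of_frame` — `F : M × ℝᵐ → ℝ^q` of class `C^∞`, `g = F(·, 0)` an
immersion with `dg_x X = dF_{(x,0)}(X, 0)`, and `dF_{(x,0)}` injective on `T_x M × E_x` — the
bundle map `x ↦ (normal projection of g at x) ∘ ∂₂F(x, 0)` is an isomorphism from `E(P)` onto the
normal bundle of `g`. [cite: Kirby1989, Ch. VI Lemma 1; Hirsch1959, Thm. 6.3] -/
theorem isIso_normal_of_hirschData (P : ProjBundle n m k M) (hq : k + n = q)
    {F : M × 𝔼 m → 𝔼 q} (hF : ContMDiff ((𝓡 n).prod (𝓡 m)) (𝓡 q) ∞ F)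
    (hg : ContMDiff (𝓡 n) (𝓡 q) ∞ fun y => F (y, 0))
    (himm : ∀ x, Injective (mfderiv (𝓡 n) (𝓡 q) (fun y => F (y, 0)) x))
    (hdg : ∀ (x : M) (X : 𝔼 n), mfderiv (𝓡 n) (𝓡 q) (fun y => F (y, 0)) x X =
      mfderiv ((𝓡 n).prod (𝓡 m)) (𝓡 q) F (x, 0) (X, (0 : 𝔼 m)))
    (hker : ∀ (x : M) (X : 𝔼 n) (w : 𝔼 m), P.proj x w = w →
      mfderiv ((𝓡 n).prod (𝓡 m)) (𝓡 q) F (x, 0) (X, w) = 0 → X = 0 ∧ w = 0) :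
    IsIso P (ProjBundle.normal hq (fun y => F (y, 0)) hg himm)
      fun x => (normalProj n (fun y => F (y, 0)) x).comp (partialFDeriv F x) := by
  refine ⟨⟨?_, fun x v _ => ?_⟩, fun x => ?_⟩
  · -- smoothness
    have h1 : ContMDiff (𝓡 n) 𝓘(ℝ, 𝔼 q →L[ℝ] 𝔼 q) ∞ (normalProj n fun y => F (y, 0)) :=
      (ProjBundle.normal hq (fun y => F (y, 0)) hg himm).contMDiff_proj'
    exact h1.clm_comp (contMDiff_partialFDeriv hF)
  · -- fibres go to normal fibres
    exact (ProjBundle.normal hq (fun y => F (y, 0)) hg himm).proj_mem_fibre x _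
  · -- injectivity on `E_x`
    intro v hv v' hv' hvv'
    have hw : v - v' ∈ P.fibre x := Submodule.sub_mem _ hv hv'
    have hwfix : P.proj x (v - v') = v - v' := P.mem_fibre_iff.1 hw
    have h0 : normalProj n (fun y => F (y, 0)) x (partialFDeriv F x (v - v')) = 0 := by
      simp only [ContinuousLinearMap.comp_apply] at hvv'
      rw [map_sub, map_sub, hvv', sub_self]
    -- `∂₂F (v - v')` is tangent: `= dg ξ = dF (ξ, 0)`
    have htan : partialFDeriv F x (v - v') ∈ tangentPlane (𝓡 n) (fun y => F (y, 0)) x := by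
      have h1 : partialFDeriv F x (v - v') ∈ (normalSpace (𝓡 n) (fun y => F (y, 0)) x)ᗮ :=
        (Submodule.starProjection_apply_eq_zero_iff _).1 h0
      rwa [Submodule.orthogonal_orthogonal] at h1
    obtain ⟨ξ, hξ⟩ : ∃ ξ : 𝔼 n, mfderiv (𝓡 n) (𝓡 q) (fun y => F (y, 0)) x ξ =
        partialFDeriv F x (v - v') := (mem_tangentPlane_iff (I := 𝓡 n)).1 htan
    rw [hdg, partialFDeriv_apply hF] at hξ
    -- `dF (ξ, -(v - v')) = 0`
    have hzero : mfderiv ((𝓡 n).prod (𝓡 m)) (𝓡 q) F (x, 0) (ξ, -(v - v')) = 0 := by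
      -- read `dF_{(x,0)}` as a plain linear map on `ℝⁿ × ℝᵐ`
      obtain ⟨f, hf⟩ : ∃ f : (𝔼 n × 𝔼 m) →L[ℝ] 𝔼 q,
          ∀ u, f u = mfderiv ((𝓡 n).prod (𝓡 m)) (𝓡 q) F (x, 0) u := ⟨_, fun _ => rfl⟩
      have e1 : f (ξ, -(v - v')) = f (ξ, 0) + f (0, -(v - v')) := by
        rw [← map_add, Prod.mk_add_mk, add_zero, zero_add]
      have e2 : f (0, -(v - v')) = -f (0, v - v') := by
        rw [← map_neg, Prod.neg_mk, neg_zero]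
      have e3 : f (ξ, 0) = f (0, v - v') := by rw [hf, hf]; exact hξ
      rw [← hf, e1, e2, e3, add_neg_cancel]
      rfl
    have hfix' : P.proj x (-(v - v')) = -(v - v') := by rw [map_neg, hwfix]
    have := (hker x ξ _ hfix' hzero).2
    exact sub_eq_zero.1 (neg_eq_zero.1 this)

end ProjBundle

end Literature.Topology.Immersions
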